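import Summits.QuantumFields.BalabanUV.Beta.ResolventTaylorCoefficients
import Literature.Analysis.ValidatedNumerics.ExpSumEnclosure

/-!
# Beta / StencilExpSums — THE TAIL NUMBERS AND THE TABLE SUPS AS KERNEL-CHECKED EXPONENTIAL SUMS: `taylorTail`, `taylorTailFin` and the
# (Z2b) tube ∕ vertex-tori sups of a stencil family bounded by `esum` of a LITERAL term list built from the offset list, RATIONAL TABLE-NORM
# BOUNDS and rational box data — discharged in the kernel by `ExpSum.checkUB` (β sub-cell, BINDER-OWNERS row CAP-k, lineage
# `b2b-balaban-beta-an5`, gen 28; node BETA-an5-g28-EXPSUM)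

WHY.  After gen 27 every per-leaf engine deliverable of a COEFFICIENT-CURRENCY leaf (`ResidualLeafRecord.certifies_ofCoeffs`, box;
`FinLeafRecord.certifies_ofCoeffs`, fin) is the Euclidean norm of finitely many explicit matrices — EXCEPT one number: the bound `T` of the
closed-form Taylor tail `taylorTail m S K c h = Σ_{x∈S} e^{−Σ_μ x_μ Im c_μ}·tailFactor m (Σ_μ |x_μ| h_μ)·‖K[x]‖` (resp. `taylorTailFin`), a finite
sum of `exp` of rationals times table norms, asserted by the writer through `hT : taylorTail ≤ T` (XREAD C-ne9leaf04g31-1 INFO-3: «per leaf the ONE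
transcendental number left … a rational `T` wants a one-sided `exp` enclosure engine-side»).  The same shape is the (Z2b) binder
`hS : ∀ i, ∀ q ∈ VertexTori κ, ‖T i q‖ ≤ S i` of `CapWordListGL(Schedules).rowsGL_ofSchedulesQ_ofPairedBall`: by `CapRouteA.norm_characterSum_le_of_mem_tube`
a stencil letter `T i q = Σ_x χ_q(x)•K_i[x]` obeys `‖T i q‖ ≤ Σ_x e^{Σ_μ |x_μ| w_μ}·‖K_i[x]‖` on the tube.  This module moves BOTH into the kernel:
given the offsets as a LIST `L` (any list with `L.toFinset = S`; duplicates only over-count), RATIONAL per-offset table-norm bounds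
`ν x ≥ ‖K x‖` (ONE rational per offset per table — the norm of an explicit matrix, the same class of deliverable as the `Z_β`; for typed rational
tables `ν x² ≥ ‖K x‖_F²` is itself decidable) and the rational box ∕ fin ∕ tube data, the three sums are bounded by `esum` of an explicit
`List ETerm` of the tree's `Literature.Analysis.ValidatedNumerics.ExpSumEnclosure`, whose Boolean checker `checkUB` (outward-rounded multi-precision
interval `exp`, `decide +kernel`) PROVES a rational upper bound.  After this module no `exp`, no sup and no tail number is asserted outside the
kernel anywhere in a coefficient-currency leaf or in (Z2b).

* §1 rational term data: `ratTerm`, `ratTerm_val`, `esum_map_ratTerm`, `esum_le_rat_of_checkUB`, `sum_toFinset_le_sum_map`; `dotQ`, `absDotQ`,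
  `tailFactorQ` (+ cast lemmas), `hsmall_of_all` (the per-leaf range condition `Σ_μ|x_μ|h_μ ≤ 1` decided on the list).
* §2 THE BOX TAIL: `tailTerms m L ν cIm h`, **`taylorTail_le_esum`**, **`taylorTail_le_of_checkUB`**; the SIGN-PATTERN-FREE form `tailTermsSup m L ν κ h`
  (`|Im c_μ| ≤ κ`), `taylorTail_le_esum_sup`, `taylorTail_le_of_checkUB_sup` — ONE kernel check serves every leaf of a uniform schedule.
* §3 RECORD ENDs (box): **`ResidualLeafRecord.certifies_ofCoeffs_ofTableNorms`** (the admitted residual record p230938; `hT` REPLACED by table norms +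
  `checkUB … = true`), **`hcert_of_residualRecords_ofCoeffs_ofTableNorms`** (per-leaf checks) and **`hcert_of_residualRecords_ofCoeffs_ofUniformTail`**
  (one check for a schedule with uniform order `m`, uniform half-widths and centres on the tube `|Im c_μ| ≤ κ` — the schedule of record's shape).
* sibling module `StencilExpSumsFinTube` (same node): §4 the FIN tail + `FinLeafRecord.certifies_ofCoeffs_ofTableNorms`, §5 the (Z2b) TABLE SUPS
  on the tube ∕ vertex tori (`tableSup_of_checkUB` = the binder `hS i` of the lane's typed target from table norms), §6 a WORKED KERNEL INSTANCE
  (81-offset stencil, `decide +kernel` in seconds, enclosures tight to 1∕100).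

HONEST FRAMING.  Kernel glue ([folklore]: monotonicity of finite sums + the tree's validated-numerics checker); no table, no record, no schedule of
the cell is supplied; 0 binders of the real row instantiated; 0 certified coefficients; discharging `BetaPertH` would make Bałaban's ultraviolet
stability UNCONDITIONAL — NOT the continuum limit, NOT the Clay problem.  HONEST DEPENDENCY: continuum YM on T⁴ ⇐ BetaPertH ∧ nine spine estimates
(0∕9 proved); BetaPertH ⇐ (D1) ∧ (D4) ∧ CAP+tail; G-an2-4 gates asym, D1 and NE2∕3∕4.  0 `sorry`, 0 cite tags.
-/

namespace Summit.QuantumFields.BalabanUV.Beta.StencilExpSums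

open Complex Set Matrix Finset
open Summit.QuantumFields.BalabanUV.Beta.PolyRegularAlgebra (character)
open Summit.QuantumFields.BalabanUV.Beta.ResolventBoxCertificate
open Literature.Analysis.ValidatedNumerics.ExpSum (ETerm esum checkUB checkLB esum_le_of_checkUB le_esum_of_checkLB)
open scoped Real Matrix.Norms.L2Operator Pointwise

noncomputable section

variable {d : ℕ} {n : Type*} [Fintype n] [DecidableEq n]

/-! ## §1 Rational term data and the bridge to `esum` -/

section Data

/-- the exponential-sum term `a · e^{q}` of two RATIONALS, in the checker's integer format `⟨a.num, a.den, q.num, q.den⟩`. [folklore] -/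
def ratTerm (a q : ℚ) : ETerm := ⟨a.num, a.den, q.num, q.den⟩

/-- its value is `a · e^{q}`. [folklore] -/
theorem ratTerm_val (a q : ℚ) : (ratTerm a q).val = (a : ℝ) * Real.exp (q : ℝ) := by
  simp only [ETerm.val, ratTerm, Rat.cast_def]

/-- `esum` of a mapped list of rational terms is the list sum of the values. [folklore] -/
theorem esum_map_ratTerm {α : Type*} (L : List α) (a q : α → ℚ) :
    esum (L.map fun x => ratTerm (a x) (q x)) = (L.map fun x => ((a x : ℚ) : ℝ) * Real.exp ((q x : ℚ) : ℝ)).sum := by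
  induction L with
  | nil => rfl
  | cons x xs ih => simp only [List.map_cons, List.sum_cons, esum, ih, ratTerm_val]

/-- **THE KERNEL CHECK READ BACK AS A RATIONAL BOUND**: `checkUB Sc Kt kt L T.num T.den = true ⟹ esum L ≤ T`. [folklore] -/
theorem esum_le_rat_of_checkUB {Sc Kt kt : ℕ} (hSc : 0 < Sc) {L : List ETerm} {T : ℚ}
    (h : checkUB Sc Kt kt L T.num T.den = true) : esum L ≤ (T : ℝ) := by
  have h1 := esum_le_of_checkUB (S := Sc) (K := Kt) (k := kt) hSc T.pos h
  rwa [← Rat.cast_def] at h1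

/-- and a rational LOWER bound: `checkLB Sc Kt kt L T.num T.den = true ⟹ T ≤ esum L`. [folklore] -/
theorem rat_le_esum_of_checkLB {Sc Kt kt : ℕ} (hSc : 0 < Sc) {L : List ETerm} {T : ℚ}
    (h : checkLB Sc Kt kt L T.num T.den = true) : (T : ℝ) ≤ esum L := by
  have h1 := le_esum_of_checkLB (S := Sc) (K := Kt) (k := kt) hSc T.pos h
  rw [Rat.cast_def]
  exact h1

/-- a `Finset` sum over `L.toFinset` of NON-NEGATIVE terms is at most the list sum (duplicates only over-count) — so no `Nodup` hypothesis is ever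
needed on the offset list. [folklore] -/
theorem sum_toFinset_le_sum_map {α : Type*} [DecidableEq α] (L : List α) (f : α → ℝ) (hf : ∀ x ∈ L, 0 ≤ f x) :
    ∑ x ∈ L.toFinset, f x ≤ (L.map f).sum := by
  rw [Finset.sum_list_map_count]
  refine Finset.sum_le_sum fun x hx => ?_
  have hxL : x ∈ L := List.mem_toFinset.mp hx
  have hc : 1 ≤ L.count x := List.count_pos_iff.mpr hxL
  rw [nsmul_eq_mul]
  have h0 := hf x hxL
  have h1 : (1 : ℝ) ≤ (L.count x : ℕ) := by exact_mod_cast hc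
  nlinarith

/-- the rational linear form `Σ_μ x_μ a_μ`. [folklore] -/
def dotQ (x : Fin (d + 1) → ℤ) (a : Fin (d + 1) → ℚ) : ℚ := ∑ μ, (x μ : ℚ) * a μ

/-- the rational weighted `ℓ¹` form `Σ_μ |x_μ| h_μ`. [folklore] -/
def absDotQ (x : Fin (d + 1) → ℤ) (h : Fin (d + 1) → ℚ) : ℚ := ∑ μ, |(x μ : ℚ)| * h μ

/-- cast of `dotQ`. [folklore] -/
theorem cast_dotQ (x : Fin (d + 1) → ℤ) (a : Fin (d + 1) → ℚ) :
    ((dotQ x a : ℚ) : ℝ) = ∑ μ, (x μ : ℝ) * ((a μ : ℚ) : ℝ) := by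
  simp only [dotQ]; push_cast; rfl

/-- cast of `absDotQ`. [folklore] -/
theorem cast_absDotQ (x : Fin (d + 1) → ℤ) (h : Fin (d + 1) → ℚ) :
    ((absDotQ x h : ℚ) : ℝ) = ∑ μ, |(x μ : ℝ)| * ((h μ : ℚ) : ℝ) := by
  simp only [absDotQ]; push_cast; rfl

/-- `absDotQ` is non-negative for non-negative half-widths. [folklore] -/
theorem absDotQ_nonneg (x : Fin (d + 1) → ℤ) {h : Fin (d + 1) → ℚ} (hh : ∀ μ, 0 ≤ h μ) : 0 ≤ absDotQ x h :=
  Finset.sum_nonneg fun μ _ => mul_nonneg (abs_nonneg _) (hh μ)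

/-- the rational tail factor `t^m · (m+1)∕(m!·m)` (= `tailFactor m t`). [folklore] -/
def tailFactorQ (m : ℕ) (t : ℚ) : ℚ := t ^ m * (((m + 1 : ℕ) : ℚ) * ((m.factorial : ℚ) * m)⁻¹)

/-- cast of `tailFactorQ`. [folklore] -/
theorem cast_tailFactorQ (m : ℕ) (t : ℚ) : ((tailFactorQ m t : ℚ) : ℝ) = tailFactor m (t : ℝ) := by
  simp only [tailFactorQ, tailFactor]; push_cast; rfl

/-- the tail factor is non-negative for `t ≥ 0`. [folklore] -/
theorem tailFactor_nonneg (m : ℕ) {t : ℝ} (ht : 0 ≤ t) : 0 ≤ tailFactor m t := by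
  unfold tailFactor; positivity

/-- **THE RANGE CONDITION DECIDED ON THE LIST**: `(∀ x ∈ L, absDotQ x h ≤ 1)` (a `decide`-able statement on literal data) gives the per-leaf
hypothesis `hsmall : ∀ x ∈ S, Σ_μ |x_μ|·h_μ ≤ 1` of the coefficient-currency leaves (XREAD C-ne9leaf04g31-1 INFO-4). [folklore] -/
theorem hsmall_of_all {L : List (Fin (d + 1) → ℤ)} {S : Finset (Fin (d + 1) → ℤ)} (hLS : L.toFinset = S) {h : Fin (d + 1) → ℚ}
    (hall : ∀ x ∈ L, absDotQ x h ≤ 1) : ∀ x ∈ S, ∑ μ, |(x μ : ℝ)| * ((h μ : ℚ) : ℝ) ≤ 1 := by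
  intro x hx
  rw [← hLS, List.mem_toFinset] at hx
  have h1 : ((absDotQ x h : ℚ) : ℝ) ≤ 1 := by exact_mod_cast hall x hx
  rwa [cast_absDotQ] at h1

end Data

/-! ## §2 The box tail as an exponential sum -/

section BoxTail

/-- THE TERM LIST OF THE BOX TAIL: for each offset `x` the term `ν_x · tailFactor m (Σ_μ|x_μ|h_μ) · e^{−Σ_μ x_μ cIm_μ}`. [folklore] -/
def tailTerms (m : ℕ) (L : List (Fin (d + 1) → ℤ)) (ν : (Fin (d + 1) → ℤ) → ℚ) (cIm h : Fin (d + 1) → ℚ) : List ETerm :=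
  L.map fun x => ratTerm (ν x * tailFactorQ m (absDotQ x h)) (-dotQ x cIm)

/-- THE SIGN-PATTERN-FREE TERM LIST: `ν_x · tailFactor m (Σ_μ|x_μ|h_μ) · e^{κ|x|₁}` (valid for every centre with `|Im c_μ| ≤ κ`). [folklore] -/
def tailTermsSup (m : ℕ) (L : List (Fin (d + 1) → ℤ)) (ν : (Fin (d + 1) → ℤ) → ℚ) (κ : ℚ) (h : Fin (d + 1) → ℚ) : List ETerm :=
  L.map fun x => ratTerm (ν x * tailFactorQ m (absDotQ x h)) (absDotQ x fun _ => κ)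

/-- **THE BOX TAIL IS BOUNDED BY THE EXPONENTIAL SUM OF ITS TERM LIST**: offsets listed by `L` (`L.toFinset = S`), table norms `‖K x‖ ≤ ν x`, the
centre's imaginary parts and the half-widths rational (`h ≥ 0`). [folklore] -/
theorem taylorTail_le_esum {m : ℕ} {L : List (Fin (d + 1) → ℤ)} {S : Finset (Fin (d + 1) → ℤ)} (hLS : L.toFinset = S)
    {K : (Fin (d + 1) → ℤ) → Matrix n n ℂ} {ν : (Fin (d + 1) → ℤ) → ℚ} (hν : ∀ x ∈ S, ‖K x‖ ≤ ν x)
    {c : Fin (d + 1) → ℂ} {cIm h : Fin (d + 1) → ℚ} (hc : ∀ μ, (c μ).im = ((cIm μ : ℚ) : ℝ)) (hh : ∀ μ, 0 ≤ h μ)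
    {hr : Fin (d + 1) → ℝ} (hhr : ∀ μ, hr μ = ((h μ : ℚ) : ℝ)) :
    taylorTail m S K c hr ≤ esum (tailTerms m L ν cIm h) := by
  rw [tailTerms, esum_map_ratTerm, taylorTail, ← hLS]
  have hterm : ∀ x ∈ L, Real.exp (-∑ μ, (x μ : ℝ) * (c μ).im) * tailFactor m (∑ μ, |(x μ : ℝ)| * hr μ) * ‖K x‖
      ≤ ((ν x * tailFactorQ m (absDotQ x h) : ℚ) : ℝ) * Real.exp ((-dotQ x cIm : ℚ) : ℝ) := by
    intro x hx
    have hxS : x ∈ S := by rw [← hLS, List.mem_toFinset]; exact hx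
    have e1 : (∑ μ, |(x μ : ℝ)| * hr μ) = ((absDotQ x h : ℚ) : ℝ) := by
      rw [cast_absDotQ]; exact Finset.sum_congr rfl fun μ _ => by rw [hhr]
    have e2 : (-∑ μ, (x μ : ℝ) * (c μ).im) = ((-dotQ x cIm : ℚ) : ℝ) := by
      rw [Rat.cast_neg, cast_dotQ]; exact congrArg Neg.neg (Finset.sum_congr rfl fun μ _ => by rw [hc])
    rw [e1, e2, Rat.cast_mul, cast_tailFactorQ]
    have h0 : 0 ≤ tailFactor m ((absDotQ x h : ℚ) : ℝ) :=
      tailFactor_nonneg m (by exact_mod_cast absDotQ_nonneg x hh)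
    calc Real.exp (((-dotQ x cIm : ℚ) : ℝ)) * tailFactor m ((absDotQ x h : ℚ) : ℝ) * ‖K x‖
        ≤ Real.exp (((-dotQ x cIm : ℚ) : ℝ)) * tailFactor m ((absDotQ x h : ℚ) : ℝ) * ν x :=
          mul_le_mul_of_nonneg_left (hν x hxS) (mul_nonneg (Real.exp_pos _).le h0)
      _ = ((ν x : ℚ) : ℝ) * tailFactor m ((absDotQ x h : ℚ) : ℝ) * Real.exp (((-dotQ x cIm : ℚ) : ℝ)) := by ring
  refine (sum_toFinset_le_sum_map L _ fun x hx => ?_).trans (List.sum_le_sum fun x hx => hterm x hx)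
  have hxS : x ∈ S := by rw [← hLS, List.mem_toFinset]; exact hx
  refine mul_nonneg (mul_nonneg (Real.exp_pos _).le (tailFactor_nonneg m (Finset.sum_nonneg fun μ _ => ?_))) (norm_nonneg _)
  rw [hhr]; exact mul_nonneg (abs_nonneg _) (by exact_mod_cast hh μ)

/-- **THE BOX TAIL FROM ONE KERNEL CHECK**: `checkUB Sc Kt kt (tailTerms m L ν cIm h) T.num T.den = true ⟹ taylorTail m S K c h ≤ T`. [folklore] -/
theorem taylorTail_le_of_checkUB {m : ℕ} {L : List (Fin (d + 1) → ℤ)} {S : Finset (Fin (d + 1) → ℤ)} (hLS : L.toFinset = S)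
    {K : (Fin (d + 1) → ℤ) → Matrix n n ℂ} {ν : (Fin (d + 1) → ℤ) → ℚ} (hν : ∀ x ∈ S, ‖K x‖ ≤ ν x)
    {c : Fin (d + 1) → ℂ} {cIm h : Fin (d + 1) → ℚ} (hc : ∀ μ, (c μ).im = ((cIm μ : ℚ) : ℝ)) (hh : ∀ μ, 0 ≤ h μ)
    {hr : Fin (d + 1) → ℝ} (hhr : ∀ μ, hr μ = ((h μ : ℚ) : ℝ))
    {Sc Kt kt : ℕ} (hSc : 0 < Sc) {T : ℚ} (hcheck : checkUB Sc Kt kt (tailTerms m L ν cIm h) T.num T.den = true) :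
    taylorTail m S K c hr ≤ (T : ℝ) :=
  (taylorTail_le_esum hLS hν hc hh hhr).trans (esum_le_rat_of_checkUB hSc hcheck)

/-- **THE SIGN-PATTERN-FREE BOUND**: for a centre anywhere on the closed tube `|Im c_μ| ≤ κ`, `taylorTail ≤ esum (tailTermsSup m L ν κ h)`. [folklore] -/
theorem taylorTail_le_esum_sup {m : ℕ} {L : List (Fin (d + 1) → ℤ)} {S : Finset (Fin (d + 1) → ℤ)} (hLS : L.toFinset = S)
    {K : (Fin (d + 1) → ℤ) → Matrix n n ℂ} {ν : (Fin (d + 1) → ℤ) → ℚ} (hν : ∀ x ∈ S, ‖K x‖ ≤ ν x)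
    {c : Fin (d + 1) → ℂ} {κ : ℚ} (hc : ∀ μ, |(c μ).im| ≤ ((κ : ℚ) : ℝ)) {h : Fin (d + 1) → ℚ} (hh : ∀ μ, 0 ≤ h μ)
    {hr : Fin (d + 1) → ℝ} (hhr : ∀ μ, hr μ = ((h μ : ℚ) : ℝ)) :
    taylorTail m S K c hr ≤ esum (tailTermsSup m L ν κ h) := by
  rw [tailTermsSup, esum_map_ratTerm, taylorTail, ← hLS]
  have hterm : ∀ x ∈ L, Real.exp (-∑ μ, (x μ : ℝ) * (c μ).im) * tailFactor m (∑ μ, |(x μ : ℝ)| * hr μ) * ‖K x‖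
      ≤ ((ν x * tailFactorQ m (absDotQ x h) : ℚ) : ℝ) * Real.exp ((absDotQ x (fun _ => κ) : ℚ) : ℝ) := by
    intro x hx
    have hxS : x ∈ S := by rw [← hLS, List.mem_toFinset]; exact hx
    have e1 : (∑ μ, |(x μ : ℝ)| * hr μ) = ((absDotQ x h : ℚ) : ℝ) := by
      rw [cast_absDotQ]; exact Finset.sum_congr rfl fun μ _ => by rw [hhr]
    have e2 : (-∑ μ, (x μ : ℝ) * (c μ).im) ≤ ((absDotQ x (fun _ => κ) : ℚ) : ℝ) := by
      rw [cast_absDotQ, ← Finset.sum_neg_distrib]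
      refine Finset.sum_le_sum fun μ _ => ?_
      calc -((x μ : ℝ) * (c μ).im) ≤ |(x μ : ℝ) * (c μ).im| := neg_le_abs _
        _ = |(x μ : ℝ)| * |(c μ).im| := abs_mul _ _
        _ ≤ |(x μ : ℝ)| * ((κ : ℚ) : ℝ) := mul_le_mul_of_nonneg_left (hc μ) (abs_nonneg _)
    rw [e1, Rat.cast_mul, cast_tailFactorQ]
    have h0 : 0 ≤ tailFactor m ((absDotQ x h : ℚ) : ℝ) :=
      tailFactor_nonneg m (by exact_mod_cast absDotQ_nonneg x hh)
    have hν0 : (0 : ℝ) ≤ ν x := (norm_nonneg _).trans (hν x hxS)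
    calc Real.exp (-∑ μ, (x μ : ℝ) * (c μ).im) * tailFactor m ((absDotQ x h : ℚ) : ℝ) * ‖K x‖
        ≤ Real.exp (((absDotQ x (fun _ => κ) : ℚ) : ℝ)) * tailFactor m ((absDotQ x h : ℚ) : ℝ) * ν x :=
          mul_le_mul (mul_le_mul_of_nonneg_right (Real.exp_le_exp.mpr e2) h0) (hν x hxS) (norm_nonneg _)
            (mul_nonneg (Real.exp_pos _).le h0)
      _ = ((ν x : ℚ) : ℝ) * tailFactor m ((absDotQ x h : ℚ) : ℝ) * Real.exp (((absDotQ x (fun _ => κ) : ℚ) : ℝ)) := by ring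
  refine (sum_toFinset_le_sum_map L _ fun x hx => ?_).trans (List.sum_le_sum fun x hx => hterm x hx)
  refine mul_nonneg (mul_nonneg (Real.exp_pos _).le (tailFactor_nonneg m (Finset.sum_nonneg fun μ _ => ?_))) (norm_nonneg _)
  rw [hhr]; exact mul_nonneg (abs_nonneg _) (by exact_mod_cast hh μ)

/-- **THE SIGN-PATTERN-FREE BOX TAIL FROM ONE KERNEL CHECK** — the same check for every leaf of a schedule with these `(m, h)` and centres on the tube
`|Im c_μ| ≤ κ`. [folklore] -/
theorem taylorTail_le_of_checkUB_sup {m : ℕ} {L : List (Fin (d + 1) → ℤ)} {S : Finset (Fin (d + 1) → ℤ)} (hLS : L.toFinset = S)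
    {K : (Fin (d + 1) → ℤ) → Matrix n n ℂ} {ν : (Fin (d + 1) → ℤ) → ℚ} (hν : ∀ x ∈ S, ‖K x‖ ≤ ν x)
    {c : Fin (d + 1) → ℂ} {κ : ℚ} (hc : ∀ μ, |(c μ).im| ≤ ((κ : ℚ) : ℝ)) {h : Fin (d + 1) → ℚ} (hh : ∀ μ, 0 ≤ h μ)
    {hr : Fin (d + 1) → ℝ} (hhr : ∀ μ, hr μ = ((h μ : ℚ) : ℝ))
    {Sc Kt kt : ℕ} (hSc : 0 < Sc) {T : ℚ} (hcheck : checkUB Sc Kt kt (tailTermsSup m L ν κ h) T.num T.den = true) :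
    taylorTail m S K c hr ≤ (T : ℝ) :=
  (taylorTail_le_esum_sup hLS hν hc hh hhr).trans (esum_le_rat_of_checkUB hSc hcheck)

end BoxTail

end

end Summit.QuantumFields.BalabanUV.Beta.StencilExpSums

/-! ## §3 Record ENDs (box): the admitted residual record with the tail CHECKED, not asserted -/

namespace Summit.QuantumFields.BalabanUV.Beta.ResolventResidualLeafRecord

open Complex Set Matrix Finset
open Summit.QuantumFields.BalabanUV.Beta.PolyRegularAlgebra (character)
open Summit.QuantumFields.BalabanUV.Beta.ResolventBoxCertificate
open Summit.QuantumFields.BalabanUV.Beta.StencilExpSums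
open Literature.Analysis.ValidatedNumerics.ExpSum (checkUB)
open scoped Real Matrix.Norms.L2Operator Pointwise

noncomputable section

variable {d : ℕ} {n : Type*} [Fintype n] [DecidableEq n] [DecidableEq (Fin (d + 1) → ℕ)]

omit [Fintype n] [DecidableEq n] [DecidableEq (Fin (d + 1) → ℕ)] in
/-- the imaginary parts of a record's centre are its `cIm` field. [folklore] -/
theorem ResidualLeafRecord.ctr_im (r : ResidualLeafRecord d) (μ : Fin (d + 1)) : (r.ctr μ).im = ((r.cIm μ : ℚ) : ℝ) := by
  simp [ResidualLeafRecord.ctr]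

omit [Fintype n] [DecidableEq n] [DecidableEq (Fin (d + 1) → ℕ)] in
/-- a record's box is EMPTY unless all half-widths are non-negative. [folklore] -/
theorem ResidualLeafRecord.h_nonneg_of_mem_box (r : ResidualLeafRecord d) {q : Fin (d + 1) → ℂ} (hq : q ∈ r.box) (μ : Fin (d + 1)) :
    0 ≤ r.h μ := by
  have h1 : |(q μ).re - (r.ctr μ).re| ≤ r.hw μ := (hq μ).1
  have h2 : (0 : ℝ) ≤ ((r.h μ : ℚ) : ℝ) := (abs_nonneg _).trans h1
  exact_mod_cast h2

/-- **THE ADMITTED RESIDUAL RECORD CERTIFIES ITS BOX FROM COEFFICIENT DATA AND TABLE NORMS — NO TAIL NUMBER ASSERTED**: as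
`ResidualLeafRecord.certifies_ofCoeffs` (p233050) with the hypothesis `hT : taylorTail ≤ T` REPLACED by the offset list `L` (`L.toFinset = S`), rational
table-norm bounds `‖K x‖ ≤ ν x` and ONE KERNEL CHECK `checkUB Sc Kt kt (tailTerms m L ν r.cIm r.h) T.num T.den = true`. [folklore] -/
theorem ResidualLeafRecord.certifies_ofCoeffs_ofTableNorms (r : ResidualLeafRecord d) (hv : r.Valid) {m : ℕ} (hm : 0 < m)
    {L : List (Fin (d + 1) → ℤ)} {S : Finset (Fin (d + 1) → ℤ)} (hLS : L.toFinset = S) (K : (Fin (d + 1) → ℤ) → Matrix n n ℂ)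
    (hsmall : ∀ x ∈ S, ∑ μ, |(x μ : ℝ)| * r.hw μ ≤ 1)
    (T_P : Finset (Fin (d + 1) → ℕ)) (Z : (Fin (d + 1) → ℕ) → Matrix n n ℂ) {ε : ℝ}
    (hE : ∑ γ ∈ insert 0 (T_P + degLT d m), monomial γ r.hw * ‖residualCoeff T_P Z m S K r.ctr γ‖ ≤ ε)
    (hP : ∑ β ∈ T_P, monomial β r.hw * ‖Z β‖ ≤ r.p)
    {ν : (Fin (d + 1) → ℤ) → ℚ} (hν : ∀ x ∈ S, ‖K x‖ ≤ ν x)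
    {Sc Kt kt : ℕ} (hSc : 0 < Sc) {T : ℚ} (hcheck : checkUB Sc Kt kt (tailTerms m L ν r.cIm r.h) T.num T.den = true)
    (hθ : ε + r.p * T ≤ r.θ) :
    ∀ q ∈ r.box, IsUnit (∑ x ∈ S, character x q • K x).det ∧ ‖(∑ x ∈ S, character x q • K x)⁻¹‖ ≤ r.B := by
  intro q hq
  have hh : ∀ μ, 0 ≤ r.h μ := r.h_nonneg_of_mem_box hq
  have hT : taylorTail m S K r.ctr r.hw ≤ (T : ℝ) :=
    taylorTail_le_of_checkUB hLS hν r.ctr_im hh (fun _ => rfl) hSc hcheck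
  exact r.certifies_ofCoeffs hv hm S K hsmall T_P Z hE hP hT hθ q hq

/-- **`hcert` FROM RESIDUAL RECORDS IN COEFFICIENT CURRENCY WITH CHECKED TAILS** (per-leaf checks): as `hcert_of_residualRecords_ofCoeffs` with the
per-leaf tail hypothesis `hT` REPLACED by global table norms `ν` and one `checkUB` per record. [folklore] -/
theorem hcert_of_residualRecords_ofCoeffs_ofTableNorms {boxes : Finset ((Fin (d + 1) → ℂ) × (Fin (d + 1) → ℝ))}
    (rec : (Fin (d + 1) → ℂ) × (Fin (d + 1) → ℝ) → ResidualLeafRecord d) {Ba : ℝ}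
    (hvalid : ∀ bx ∈ boxes, (rec bx).Valid ∧ ((rec bx).B : ℝ) ≤ Ba)
    (hsub : ∀ bx ∈ boxes, Box bx.1 bx.2 ⊆ (rec bx).box)
    {L : List (Fin (d + 1) → ℤ)} {S : Finset (Fin (d + 1) → ℤ)} (hLS : L.toFinset = S) (K : (Fin (d + 1) → ℤ) → Matrix n n ℂ)
    (hsmall : ∀ bx ∈ boxes, ∀ x ∈ S, ∑ μ, |(x μ : ℝ)| * (rec bx).hw μ ≤ 1)
    (m : (Fin (d + 1) → ℂ) × (Fin (d + 1) → ℝ) → ℕ) (hm : ∀ bx ∈ boxes, 0 < m bx)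
    (T_P : (Fin (d + 1) → ℂ) × (Fin (d + 1) → ℝ) → Finset (Fin (d + 1) → ℕ))
    (Z : (Fin (d + 1) → ℂ) × (Fin (d + 1) → ℝ) → (Fin (d + 1) → ℕ) → Matrix n n ℂ)
    (ε : (Fin (d + 1) → ℂ) × (Fin (d + 1) → ℝ) → ℝ)
    (hE : ∀ bx ∈ boxes, ∑ γ ∈ insert 0 (T_P bx + degLT d (m bx)), monomial γ (rec bx).hw *
      ‖residualCoeff (T_P bx) (Z bx) (m bx) S K (rec bx).ctr γ‖ ≤ ε bx)
    (hP : ∀ bx ∈ boxes, ∑ β ∈ T_P bx, monomial β (rec bx).hw * ‖Z bx β‖ ≤ (rec bx).p)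
    {ν : (Fin (d + 1) → ℤ) → ℚ} (hν : ∀ x ∈ S, ‖K x‖ ≤ ν x)
    {Sc Kt kt : ℕ} (hSc : 0 < Sc) (T : (Fin (d + 1) → ℂ) × (Fin (d + 1) → ℝ) → ℚ)
    (hcheck : ∀ bx ∈ boxes, checkUB Sc Kt kt (tailTerms (m bx) L ν (rec bx).cIm (rec bx).h) (T bx).num (T bx).den = true)
    (hθ : ∀ bx ∈ boxes, ε bx + (rec bx).p * T bx ≤ (rec bx).θ) :
    ∀ bx ∈ boxes, ∀ q ∈ Box bx.1 bx.2,
      IsUnit (∑ x ∈ S, character x q • K x).det ∧ ‖(∑ x ∈ S, character x q • K x)⁻¹‖ ≤ Ba := fun bx hbx q hq =>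
  let h := (rec bx).certifies_ofCoeffs_ofTableNorms (hvalid bx hbx).1 (hm bx hbx) hLS K (hsmall bx hbx) (T_P bx) (Z bx)
    (hE bx hbx) (hP bx hbx) hν hSc (hcheck bx hbx) (hθ bx hbx) q (hsub bx hbx hq)
  ⟨h.1, h.2.trans (hvalid bx hbx).2⟩

/-- **`hcert` WITH ONE TAIL CHECK FOR THE WHOLE SCHEDULE** (the schedule of record's shape: uniform order `m₀`, uniform half-widths `h₀`, every
centre on the closed tube `|Im c_μ| ≤ κ`): the sign-pattern-free check `checkUB Sc Kt kt (tailTermsSup m₀ L ν κ h₀) T.num T.den = true` serves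
every leaf. [folklore] -/
theorem hcert_of_residualRecords_ofCoeffs_ofUniformTail {boxes : Finset ((Fin (d + 1) → ℂ) × (Fin (d + 1) → ℝ))}
    (rec : (Fin (d + 1) → ℂ) × (Fin (d + 1) → ℝ) → ResidualLeafRecord d) {Ba : ℝ}
    (hvalid : ∀ bx ∈ boxes, (rec bx).Valid ∧ ((rec bx).B : ℝ) ≤ Ba)
    (hsub : ∀ bx ∈ boxes, Box bx.1 bx.2 ⊆ (rec bx).box)
    {L : List (Fin (d + 1) → ℤ)} {S : Finset (Fin (d + 1) → ℤ)} (hLS : L.toFinset = S) (K : (Fin (d + 1) → ℤ) → Matrix n n ℂ)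
    {m₀ : ℕ} (hm₀ : 0 < m₀) {h₀ : Fin (d + 1) → ℚ} (hh₀ : ∀ μ, 0 ≤ h₀ μ) (hh : ∀ bx ∈ boxes, (rec bx).h = h₀)
    {κ : ℚ} (hκ : ∀ bx ∈ boxes, ∀ μ, |(rec bx).cIm μ| ≤ κ)
    (hsmall : ∀ x ∈ S, ∑ μ, |(x μ : ℝ)| * ((h₀ μ : ℚ) : ℝ) ≤ 1)
    (T_P : (Fin (d + 1) → ℂ) × (Fin (d + 1) → ℝ) → Finset (Fin (d + 1) → ℕ))
    (Z : (Fin (d + 1) → ℂ) × (Fin (d + 1) → ℝ) → (Fin (d + 1) → ℕ) → Matrix n n ℂ)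
    (ε : (Fin (d + 1) → ℂ) × (Fin (d + 1) → ℝ) → ℝ)
    (hE : ∀ bx ∈ boxes, ∑ γ ∈ insert 0 (T_P bx + degLT d m₀), monomial γ (rec bx).hw *
      ‖residualCoeff (T_P bx) (Z bx) m₀ S K (rec bx).ctr γ‖ ≤ ε bx)
    (hP : ∀ bx ∈ boxes, ∑ β ∈ T_P bx, monomial β (rec bx).hw * ‖Z bx β‖ ≤ (rec bx).p)
    {ν : (Fin (d + 1) → ℤ) → ℚ} (hν : ∀ x ∈ S, ‖K x‖ ≤ ν x)
    {Sc Kt kt : ℕ} (hSc : 0 < Sc) {T : ℚ} (hcheck : checkUB Sc Kt kt (tailTermsSup m₀ L ν κ h₀) T.num T.den = true)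
    (hθ : ∀ bx ∈ boxes, ε bx + (rec bx).p * T ≤ (rec bx).θ) :
    ∀ bx ∈ boxes, ∀ q ∈ Box bx.1 bx.2,
      IsUnit (∑ x ∈ S, character x q • K x).det ∧ ‖(∑ x ∈ S, character x q • K x)⁻¹‖ ≤ Ba := by
  intro bx hbx q hq
  have hhw : ∀ μ, (rec bx).hw μ = ((h₀ μ : ℚ) : ℝ) := fun μ => by
    show (((rec bx).h μ : ℚ) : ℝ) = _; rw [hh bx hbx]
  have hc : ∀ μ, |((rec bx).ctr μ).im| ≤ ((κ : ℚ) : ℝ) := fun μ => by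
    rw [(rec bx).ctr_im]; exact_mod_cast hκ bx hbx μ
  have hT : taylorTail m₀ S K (rec bx).ctr (rec bx).hw ≤ (T : ℝ) :=
    taylorTail_le_of_checkUB_sup hLS hν hc hh₀ hhw hSc hcheck
  have hsmall' : ∀ x ∈ S, ∑ μ, |(x μ : ℝ)| * (rec bx).hw μ ≤ 1 := fun x hx => by
    simpa only [hhw] using hsmall x hx
  have h := (rec bx).certifies_ofCoeffs (hvalid bx hbx).1 hm₀ S K hsmall' (T_P bx) (Z bx) (hE bx hbx) (hP bx hbx) hT
    (hθ bx hbx) q (hsub bx hbx hq)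
  exact ⟨h.1, h.2.trans (hvalid bx hbx).2⟩

end

end Summit.QuantumFields.BalabanUV.Beta.ResolventResidualLeafRecord
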